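import Mathlib
import HarnessLib
import Summits.HubbardSuperconductivity.HubbardSuperconductivity.Theorems.KLProgrammeKLRegimeCountertermOneVolumeMs

/-!
# Route `KLProgramme` — child `KLRegimeCounterterm` of crux K3, ANY GENERATION (`CountertermP2 Pr klWindowC`, gen 3 = stmt-HubbardSuperconductivity-19825
# on `klPredsV11`, gen 4 on `klPredsV12`, …): THE WHOLESALE CONTINUATION AT ONE VOLUME, RE-KEYED ON AN ARBITRARY HISTORY
# (seat hubbard-kl-k3c3-p2, «fixed point on FrameOK's tube, contraction in the frame norm»)

`…CountertermContinuation` / `…CountertermOneVolumeMs` prove the one-volume construction from a hypothesis block spelled with the V11 slots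
(`EngineBoundsAtV7S ∧ TwoLegStepV11 ∧ BetaSplitAtS2`).  The proof reads the engine and split conjuncts ONLY to assemble the comparison-frame
history `histV10` demanded by (E3c) frame-Lipschitz — bookkeeping, not content.  This module re-proves the same chain keyed on an ARBITRARY
history predicate `H : TrigPolyC4v → ℕ → Prop` at the volume: the block is
`TwoLegStepG H ∧ TwoLegSizesMS ∧ TwoLegAngularG ∧ (RenormalisedAtF n → H K n)` for every admissible frame renormalised below the scale, so that
every bundle whose two-leg slot has the V11 SHAPE (any engine slot, any split slot, any history built from them — `klPredsV11`, `klPredsV12`, …)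
instantiates it (`…CountertermShape`).  Proofs are those of `…CountertermContinuation` §3–§4 and `…CountertermOneVolumeMs` §2–§3 verbatim up to
the block's shape.  Main results: `ct_stepH`, `ct_exists_postH`, `ct_oneVolume_of_readingH` (this file); the reading from the block and the thresholds /
one-volume construction `ct_oneVolume_thresholdsH` are in `…CountertermOneVolumeH`.  Proofs only; nothing is asserted about the Hubbard model.
-/

noncomputable section

namespace Summit.HubbardSuperconductivity.HubbardSuperconductivity.Theorems.KLRegimeSplit

set_option linter.dupNamespace false -- summit = problem name (single-conjunct summit), D-0017

open Real Finset
open Literature.MathematicalPhysics.QuantumLattice Literature.Probability.LatticeModels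
open Summit.HubbardSuperconductivity.HubbardSuperconductivity.Theorems.KLProgrammeLegKernels

/-! ## §1 The history-keyed block at one volume -/

section Block

variable {L M : ℕ} [NeZero L] [NeZero M] {G : GeoConsts} {P : SplitConsts} {Q : EngConsts} {β U μ : ℝ} {R : RenConsts}
  {H : TrigPolyC4v → ℕ → Prop}

/-- From a history-keyed block: the scale-`i` piece of a frame renormalised below `i` is bounded by `twoLegBar 0 i` everywhere
((E3a) tier 1, `j = 0`). -/
theorem abs_eval_piece_le_of_blockH
    (blk : ∀ K : TrigPolyC4v, FrameOK R U (nScales β) μ K → ∀ n : ℕ, n ≤ nScales β →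
      (∀ j < n, RenormalisedAtF L M β U μ K R j) →
        TwoLegStepG L M H G P Q R β U μ K n ∧ TwoLegSizesMS L M G Q R β U μ K n ∧ TwoLegAngularG L M G Q R β U μ K n ∧
          (RenormalisedAtF L M β U μ K R n → H K n))
    {K : TrigPolyC4v} (hK : FrameOK R U (nScales β) μ K) {i : ℕ} (hi : i ≤ nScales β)
    (hren : ∀ j < i, RenormalisedAtF L M β U μ K R j) (p : Fin 2 → ℝ) :
    |(klTwoLegPieceG L M β U μ K i).eval p| ≤ twoLegBar G Q U 0 i := by
  have h := ((blk K hK i hi hren).1).1.1 0 (by norm_num) (WithLp.toLp 2 p)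
  rw [norm_iteratedFDeriv_zero, Real.norm_eq_abs] at h
  simpa [evalM] using h

/-- **Self-map at this volume** (history-keyed block): for an admissible frame renormalised below `n ≤ N`, `Φ_n(K)` is admissible
(`frameOK_of_multiSlot` fed by the block's (E3a-MS) at the scales `i ≤ n`). -/
theorem ct_frameOK_counterIterH (hG : G.WF) (hQ : Q.WF) (hμ : μ ∈ klWindowC) (hR : ∀ j, 0 ≤ R.Gfr j)
    (blk : ∀ K : TrigPolyC4v, FrameOK R U (nScales β) μ K → ∀ n : ℕ, n ≤ nScales β →
      (∀ j < n, RenormalisedAtF L M β U μ K R j) →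
        TwoLegStepG L M H G P Q R β U μ K n ∧ TwoLegSizesMS L M G Q R β U μ K n ∧ TwoLegAngularG L M G Q R β U μ K n ∧
          (RenormalisedAtF L M β U μ K R n → H K n))
    (hroomA : ∀ j ≤ 4, 2 * (G.S j + Q.S' j * |U|) ≤ R.Gfr j) (hroomB : ∀ n : ℕ, ∑ i ∈ range (n + 1), msBar G Q U i ≤ 1 / 2)
    (h0 : ∑ m ∈ range (nScales β + 1), R.Gfr 0 * uPow 0 U * (4 : ℝ) ^ (((0 : ℤ) - 2) * m) ≤ 3 / 80)
    (h1 : ∑ m ∈ range (nScales β + 1), R.Gfr 1 * uPow 1 U * (4 : ℝ) ^ (((1 : ℤ) - 2) * m) ≤ 1 / 2000)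
    (h2 : ∑ m ∈ range (nScales β + 1), ∑ j ∈ range 3, R.Gfr j * uPow j U * (4 : ℝ) ^ (((j : ℤ) - 2) * m) ≤ 1 / 100)
    {K : TrigPolyC4v} (hK : FrameOK R U (nScales β) μ K) {n : ℕ} (hn : n ≤ nScales β)
    (hren : ∀ j < n, RenormalisedAtF L M β U μ K R j) :
    FrameOK R U (nScales β) μ (fsub (klFrameProjG L μ K) (klTwoLegPolyG L M β U μ K n)) := by
  refine frameOK_of_multiSlot (L := L) (M := M) hG hQ hR hn hμ (fun i hi => ?_) hroomA (hroomB n) h0 h1 h2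
  exact (blk K hK i (hi.trans hn) fun j hj => hren j (lt_of_lt_of_le hj hi)).2.1

end Block

/-! ## §2 One Picard step, history-keyed -/

section Step

variable {L M : ℕ} [NeZero L] [NeZero M] {G : GeoConsts} {P : SplitConsts} {Q : EngConsts} {β U μ : ℝ} {R : RenConsts}
  {H : TrigPolyC4v → ℕ → Prop} (wig : ℕ → ℝ)

/-- **ONE PICARD STEP at level `n`, history-keyed.**  From an admissible `K` renormalised below `n` with `sup|S_n(K)| ≤ δ`, and the
feasibility `T̄_{j,n} + q·δ + wig j ≤ tol_j` (`j ≤ n`): `K′ = Φ_n(K)` is admissible, renormalised at every `j ≤ n`, and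
`sup|S_j(K′)| ≤ T̄_{j,n} + q·δ`.  The comparison-frame history `H K′ j′` (`j′ < j`) demanded by (E3c) is produced by the block's last
conjunct from the renormalisation of `K′` at `j′`, which the strong induction on `j` has already established. -/
theorem ct_stepH (hG : G.WF) (hQ : Q.WF) (hμ : μ ∈ klWindowC) (hR : ∀ j, 0 ≤ R.Gfr j) (hcr : R.cr = ctCr G)
    (blk : ∀ K : TrigPolyC4v, FrameOK R U (nScales β) μ K → ∀ n : ℕ, n ≤ nScales β →
      (∀ j < n, RenormalisedAtF L M β U μ K R j) →
        TwoLegStepG L M H G P Q R β U μ K n ∧ TwoLegSizesMS L M G Q R β U μ K n ∧ TwoLegAngularG L M G Q R β U μ K n ∧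
          (RenormalisedAtF L M β U μ K R n → H K n))
    (hread : ∀ K : TrigPolyC4v, FrameOK R U (nScales β) μ K → ∀ n : ℕ, n ≤ nScales β →
      (∀ j < n, RenormalisedAtF L M β U μ K R j) → ∀ B : ℝ,
        (∀ q : Fin 2 → ℝ, |K.eval q + ∑ i ∈ range (n + 1), (klTwoLegPieceG L M β U μ K i).eval q| ≤ B) →
          ∀ θ : ℝ, |klLocalPart L M β U μ K n θ| ≤ B + wig n)
    (hroomA : ∀ j ≤ 4, 2 * (G.S j + Q.S' j * |U|) ≤ R.Gfr j) (hroomB : ∀ n : ℕ, ∑ i ∈ range (n + 1), msBar G Q U i ≤ 1 / 2)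
    (h0 : ∑ m ∈ range (nScales β + 1), R.Gfr 0 * uPow 0 U * (4 : ℝ) ^ (((0 : ℤ) - 2) * m) ≤ 3 / 80)
    (h1 : ∑ m ∈ range (nScales β + 1), R.Gfr 1 * uPow 1 U * (4 : ℝ) ^ (((1 : ℤ) - 2) * m) ≤ 1 / 2000)
    (h2 : ∑ m ∈ range (nScales β + 1), ∑ j ∈ range 3, R.Gfr j * uPow j U * (4 : ℝ) ^ (((j : ℤ) - 2) * m) ≤ 1 / 100)
    {K : TrigPolyC4v} (hK : FrameOK R U (nScales β) μ K) {n : ℕ} (hn : n ≤ nScales β)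
    (hren : ∀ j < n, RenormalisedAtF L M β U μ K R j) {δ : ℝ} (hδ0 : 0 ≤ δ)
    (hδ : ∀ q : Fin 2 → ℝ, |K.eval q + ∑ i ∈ range (n + 1), (klTwoLegPieceG L M β U μ K i).eval q| ≤ δ)
    (hfeas : ∀ j ≤ n, ∑ i ∈ Ico (j + 1) (n + 1), twoLegBar G Q U 0 i + 4 / 3 * (G.SL + Q.SL * |U|) * |U| * δ + wig j ≤
      ctCr G * |U| * klScale klE0 j ^ 2 / klE0) :
    FrameOK R U (nScales β) μ (fsub (klFrameProjG L μ K) (klTwoLegPolyG L M β U μ K n)) ∧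
    (∀ j ≤ n, RenormalisedAtF L M β U μ (fsub (klFrameProjG L μ K) (klTwoLegPolyG L M β U μ K n)) R j) ∧
    (∀ j ≤ n, ∀ q : Fin 2 → ℝ,
      |(fsub (klFrameProjG L μ K) (klTwoLegPolyG L M β U μ K n)).eval q +
          ∑ i ∈ range (j + 1), (klTwoLegPieceG L M β U μ (fsub (klFrameProjG L μ K) (klTwoLegPolyG L M β U μ K n)) i).eval q| ≤
        ∑ i ∈ Ico (j + 1) (n + 1), twoLegBar G Q U 0 i + 4 / 3 * (G.SL + Q.SL * |U|) * |U| * δ) := by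
  set K' := fsub (klFrameProjG L μ K) (klTwoLegPolyG L M β U μ K n) with hK'def
  set qq : ℝ := 4 / 3 * (G.SL + Q.SL * |U|) * |U| with hqq
  have hK' : FrameOK R U (nScales β) μ K' := ct_frameOK_counterIterH hG hQ hμ hR blk hroomA hroomB h0 h1 h2 hK hn hren
  -- the frame distance of the step
  have hdist : frameDist K K' ≤ δ := by
    refine ciSup_le fun p => ?_
    rw [← partialSum_eq_sub_counterIter]
    exact hδ p
  have hlip0 : ∀ i, 0 ≤ lipBar G Q U i := by
    intro i
    have hSL : 0 ≤ G.SL := hG.2.2.2.2.2.2.2.2.2.2.2.2.2.2.2.2.2.2.2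
    have hSL' : 0 ≤ Q.SL := hQ.2.2.2.2.2.2.1
    rw [ct_lipBar_eq]; positivity
  -- strong induction on the scale `j ≤ n`
  have main : ∀ j, j ≤ n →
      (∀ q : Fin 2 → ℝ, |K'.eval q + ∑ i ∈ range (j + 1), (klTwoLegPieceG L M β U μ K' i).eval q| ≤
        ∑ i ∈ Ico (j + 1) (n + 1), twoLegBar G Q U 0 i + qq * δ) ∧
      RenormalisedAtF L M β U μ K' R j := by
    intro j
    induction j using Nat.strong_induction_on with
    | _ j ih =>
      intro hj
      -- the history of `K'` below `j`
      have hrenK' : ∀ j' < j, RenormalisedAtF L M β U μ K' R j' := fun j' hj' => (ih j' hj' (le_of_lt (lt_of_lt_of_le hj' hj))).2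
      have hhist : ∀ j' < j, H K' j' := by
        intro j' hj'
        have hb := blk K' hK' j' (le_of_lt (lt_of_lt_of_le (lt_of_lt_of_le hj' hj) hn)) fun i hi => hrenK' i (hi.trans hj')
        exact hb.2.2.2 (hrenK' j' hj')
      -- the bound on `S_j(K')`
      have hbound : ∀ q : Fin 2 → ℝ, |K'.eval q + ∑ i ∈ range (j + 1), (klTwoLegPieceG L M β U μ K' i).eval q| ≤
          ∑ i ∈ Ico (j + 1) (n + 1), twoLegBar G Q U 0 i + qq * δ := by
        intro q
        have hsplit := Finset.sum_range_add_sum_Ico (fun i => (klTwoLegPieceG L M β U μ K i).eval q) (Nat.succ_le_succ hj)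
        have hK'q : K'.eval q = -∑ i ∈ range (n + 1), (klTwoLegPieceG L M β U μ K i).eval q := eval_counterImage L M β U μ K n q
        have hident : K'.eval q + ∑ i ∈ range (j + 1), (klTwoLegPieceG L M β U μ K' i).eval q =
            ∑ i ∈ range (j + 1), ((klTwoLegPieceG L M β U μ K' i).eval q - (klTwoLegPieceG L M β U μ K i).eval q) -
              ∑ i ∈ Ico (j + 1) (n + 1), (klTwoLegPieceG L M β U μ K i).eval q := by
          rw [hK'q, ← hsplit, sum_sub_distrib]; ring
        rw [hident]
        -- Lipschitz part
        have hlipsum : |∑ i ∈ range (j + 1), ((klTwoLegPieceG L M β U μ K' i).eval q - (klTwoLegPieceG L M β U μ K i).eval q)| ≤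
            qq * δ := by
          refine (abs_sum_le_sum_abs _ _).trans ?_
          have hterm : ∀ i ∈ range (j + 1),
              |(klTwoLegPieceG L M β U μ K' i).eval q - (klTwoLegPieceG L M β U μ K i).eval q| ≤ lipBar G Q U i * δ := by
            intro i hi
            have hij : i ≤ j := Nat.lt_succ_iff.mp (mem_range.mp hi)
            have hin : i ≤ nScales β := (hij.trans hj).trans hn
            have hlipi := ((blk K hK i hin fun j' hj' => hren j' (lt_of_lt_of_le hj' (hij.trans hj))).1).2.2.1
            have h := hlipi K' hK' (fun j' hj' => hhist j' (lt_of_lt_of_le hj' hij)) q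
            rw [abs_sub_comm] at h
            exact h.trans (mul_le_mul_of_nonneg_left hdist (hlip0 i))
          refine (sum_le_sum hterm).trans ?_
          rw [← sum_mul]
          exact mul_le_mul_of_nonneg_right (ct_sum_lipBar_le hG hQ U (j + 1)) hδ0
        -- tail part
        have htailsum : |∑ i ∈ Ico (j + 1) (n + 1), (klTwoLegPieceG L M β U μ K i).eval q| ≤
            ∑ i ∈ Ico (j + 1) (n + 1), twoLegBar G Q U 0 i := by
          refine (abs_sum_le_sum_abs _ _).trans (sum_le_sum fun i hi => ?_)
          have hin : i ≤ n := Nat.lt_succ_iff.mp (mem_Ico.mp hi).2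
          exact abs_eval_piece_le_of_blockH blk hK (hin.trans hn) (fun j' hj' => hren j' (lt_of_lt_of_le hj' hin)) q
        calc |∑ i ∈ range (j + 1), ((klTwoLegPieceG L M β U μ K' i).eval q - (klTwoLegPieceG L M β U μ K i).eval q) -
              ∑ i ∈ Ico (j + 1) (n + 1), (klTwoLegPieceG L M β U μ K i).eval q|
            ≤ |∑ i ∈ range (j + 1), ((klTwoLegPieceG L M β U μ K' i).eval q - (klTwoLegPieceG L M β U μ K i).eval q)| +
              |∑ i ∈ Ico (j + 1) (n + 1), (klTwoLegPieceG L M β U μ K i).eval q| := abs_sub _ _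
          _ ≤ qq * δ + ∑ i ∈ Ico (j + 1) (n + 1), twoLegBar G Q U 0 i := add_le_add hlipsum htailsum
          _ = _ := by ring
      refine ⟨hbound, ?_⟩
      -- renormalisation at `j` by the reading hypothesis
      intro θ
      have h := hread K' hK' j (hj.trans hn) hrenK' _ hbound θ
      have hf := hfeas j hj
      show |klLocalPart L M β U μ K' j θ| ≤ R.cr * |U| * klScale klE0 j ^ 2 / klE0
      rw [hcr]
      linarith
  exact ⟨hK', fun j hj => (main j hj).2, fun j hj => (main j hj).1⟩

/-- **LEVEL-UP** (history-keyed block): a frame renormalised at every `j ≤ n` with `sup|S_n(K)| ≤ e` has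
`sup|S_{n+1}(K)| ≤ e + twoLegBar 0 (n+1)`. -/
theorem ct_levelUpH
    (blk : ∀ K : TrigPolyC4v, FrameOK R U (nScales β) μ K → ∀ n : ℕ, n ≤ nScales β →
      (∀ j < n, RenormalisedAtF L M β U μ K R j) →
        TwoLegStepG L M H G P Q R β U μ K n ∧ TwoLegSizesMS L M G Q R β U μ K n ∧ TwoLegAngularG L M G Q R β U μ K n ∧
          (RenormalisedAtF L M β U μ K R n → H K n))
    {K : TrigPolyC4v} (hK : FrameOK R U (nScales β) μ K) {n : ℕ} (hn : n + 1 ≤ nScales β)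
    (hren : ∀ j ≤ n, RenormalisedAtF L M β U μ K R j) {e : ℝ}
    (hS : ∀ q : Fin 2 → ℝ, |K.eval q + ∑ i ∈ range (n + 1), (klTwoLegPieceG L M β U μ K i).eval q| ≤ e) :
    (∀ j < n + 1, RenormalisedAtF L M β U μ K R j) ∧
    ∀ q : Fin 2 → ℝ, |K.eval q + ∑ i ∈ range (n + 1 + 1), (klTwoLegPieceG L M β U μ K i).eval q| ≤ e + twoLegBar G Q U 0 (n + 1) := by
  have hren' : ∀ j < n + 1, RenormalisedAtF L M β U μ K R j := fun j hj => hren j (Nat.lt_succ_iff.mp hj)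
  refine ⟨hren', fun q => ?_⟩
  rw [sum_range_succ, ← add_assoc]
  refine (abs_add_le _ _).trans (add_le_add (hS q) ?_)
  exact abs_eval_piece_le_of_blockH blk hK hn hren' q

end Step

/-! ## §3 The induction over the levels and the one-volume continuation, history-keyed -/

section Main

variable {L M : ℕ} [NeZero L] [NeZero M] {G : GeoConsts} {P : SplitConsts} {Q : EngConsts} {β U μ : ℝ} {R : RenConsts}
  {H : TrigPolyC4v → ℕ → Prop} (wig : ℕ → ℝ)

/-- **The induction over the levels** (one Picard step per level, history-keyed block): for every `n ≤ N` there is an admissible frame,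
renormalised at every `j ≤ n`, with `sup|S_j(K)| ≤ T̄_{j,n} + q·(2·twoLegBar 0 n)` for `j ≤ n`. -/
theorem ct_exists_postH (hG : G.WF) (hQ : Q.WF) (hμ : μ ∈ klWindowC) (hR : ∀ j, 0 ≤ R.Gfr j) (hcr : R.cr = ctCr G)
    (blk : ∀ K : TrigPolyC4v, FrameOK R U (nScales β) μ K → ∀ n : ℕ, n ≤ nScales β →
      (∀ j < n, RenormalisedAtF L M β U μ K R j) →
        TwoLegStepG L M H G P Q R β U μ K n ∧ TwoLegSizesMS L M G Q R β U μ K n ∧ TwoLegAngularG L M G Q R β U μ K n ∧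
          (RenormalisedAtF L M β U μ K R n → H K n))
    (hread : ∀ K : TrigPolyC4v, FrameOK R U (nScales β) μ K → ∀ n : ℕ, n ≤ nScales β →
      (∀ j < n, RenormalisedAtF L M β U μ K R j) → ∀ B : ℝ,
        (∀ q : Fin 2 → ℝ, |K.eval q + ∑ i ∈ range (n + 1), (klTwoLegPieceG L M β U μ K i).eval q| ≤ B) →
          ∀ θ : ℝ, |klLocalPart L M β U μ K n θ| ≤ B + wig n)
    (hwig : ∀ n ≤ nScales β, wig n ≤ |U| * ((16 : ℝ) ^ n)⁻¹ / 256)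
    (hS0' : Q.S' 0 * |U| ≤ 1 / 10) (hq : 4 / 3 * (G.SL + Q.SL * |U|) * |U| ≤ 1 / 1000)
    (hroomA : ∀ j ≤ 4, 2 * (G.S j + Q.S' j * |U|) ≤ R.Gfr j) (hroomB : ∀ n : ℕ, ∑ i ∈ range (n + 1), msBar G Q U i ≤ 1 / 2)
    (h0 : ∑ m ∈ range (nScales β + 1), R.Gfr 0 * uPow 0 U * (4 : ℝ) ^ (((0 : ℤ) - 2) * m) ≤ 3 / 80)
    (h1 : ∑ m ∈ range (nScales β + 1), R.Gfr 1 * uPow 1 U * (4 : ℝ) ^ (((1 : ℤ) - 2) * m) ≤ 1 / 2000)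
    (h2 : ∑ m ∈ range (nScales β + 1), ∑ j ∈ range 3, R.Gfr j * uPow j U * (4 : ℝ) ^ (((j : ℤ) - 2) * m) ≤ 1 / 100)
    (n : ℕ) (hn : n ≤ nScales β) :
    ∃ K : TrigPolyC4v, FrameOK R U (nScales β) μ K ∧ (∀ j ≤ n, RenormalisedAtF L M β U μ K R j) ∧
      ∀ j ≤ n, ∀ q : Fin 2 → ℝ, |K.eval q + ∑ i ∈ range (j + 1), (klTwoLegPieceG L M β U μ K i).eval q| ≤
        ∑ i ∈ Ico (j + 1) (n + 1), twoLegBar G Q U 0 i + 4 / 3 * (G.SL + Q.SL * |U|) * |U| * (2 * twoLegBar G Q U 0 n) := by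
  have htlb0 : ∀ i, 0 ≤ twoLegBar G Q U 0 i := fun i => twoLegBar_nonneg' hG hQ U 0 i
  have hqq0 : 0 ≤ 4 / 3 * (G.SL + Q.SL * |U|) * |U| := by
    have hSL : 0 ≤ G.SL := hG.2.2.2.2.2.2.2.2.2.2.2.2.2.2.2.2.2.2.2
    have hSL' : 0 ≤ Q.SL := hQ.2.2.2.2.2.2.1
    positivity
  -- feasibility of a step at level `m` with pre-step bound `2·twoLegBar 0 m`
  have hfeas : ∀ m ≤ nScales β, ∀ j ≤ m,
      ∑ i ∈ Ico (j + 1) (m + 1), twoLegBar G Q U 0 i + 4 / 3 * (G.SL + Q.SL * |U|) * |U| * (2 * twoLegBar G Q U 0 m) + wig j ≤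
        ctCr G * |U| * klScale klE0 j ^ 2 / klE0 := by
    intro m hm j hj
    have h := ct_budget wig hG hQ hwig hS0' hq hj hm
    have htolpos : 0 ≤ ctCr G * |U| * klScale klE0 j ^ 2 / klE0 := by
      have hS : 0 ≤ G.S 0 := hG.2.2.2.2.2.2.2.2.2.2.2.2.2.2.2.2.2.1 0
      have : 0 ≤ ctCr G := by unfold ctCr; positivity
      have he0 : (0 : ℝ) < klE0 := by norm_num [klE0]
      positivity
    linarith
  induction n with
  | zero =>
    -- the zero frame is admissible; one step at level 0
    have hzero : FrameOK R U (nScales β) μ (0 : TrigPolyC4v) := by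
      refine frameOK_of_pieces hR hμ (K := 0) (Kp := fun _ => 0) (N := nScales β) (fun p => by simp [eval_fsub]) ?_ h0 h1 h2
      intro m _ j _ q
      rw [evalM_zero_eq, iteratedFDeriv_fun_zero]
      simp only [Pi.zero_apply, norm_zero]
      exact mul_nonneg (mul_nonneg (hR j) (uPow_nonneg j U)) (zpow_nonneg (by norm_num) _)
    have hpre : ∀ q : Fin 2 → ℝ, |(0 : TrigPolyC4v).eval q + ∑ i ∈ range (0 + 1), (klTwoLegPieceG L M β U μ 0 i).eval q| ≤
        2 * twoLegBar G Q U 0 0 := by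
      intro q
      rw [TrigPolyC4v.eval_zero, zero_add, zero_add, sum_range_one]
      have := abs_eval_piece_le_of_blockH blk hzero (i := 0) (Nat.zero_le _) (fun j hj => absurd hj (Nat.not_lt_zero j)) q
      linarith [htlb0 0]
    obtain ⟨hK', hren', hS'⟩ := ct_stepH wig hG hQ hμ hR hcr blk hread hroomA hroomB h0 h1 h2 hzero (Nat.zero_le _)
      (fun j hj => absurd hj (Nat.not_lt_zero j)) (by linarith [htlb0 0]) hpre (hfeas 0 hn)
    exact ⟨_, hK', hren', hS'⟩
  | succ n ih =>
    obtain ⟨K, hK, hren, hS⟩ := ih (Nat.le_of_succ_le hn)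
    -- level-up: pre-step data at level `n + 1`
    have hSn : ∀ q : Fin 2 → ℝ, |K.eval q + ∑ i ∈ range (n + 1), (klTwoLegPieceG L M β U μ K i).eval q| ≤
        4 / 3 * (G.SL + Q.SL * |U|) * |U| * (2 * twoLegBar G Q U 0 n) := by
      intro q
      have h := hS n le_rfl q
      rwa [Finset.Ico_self, sum_empty, zero_add] at h
    obtain ⟨hren', hpre⟩ := ct_levelUpH blk hK hn hren hSn
    -- the pre-step bound is at most `2·twoLegBar 0 (n+1)`
    have hpre' : ∀ q : Fin 2 → ℝ, |K.eval q + ∑ i ∈ range (n + 1 + 1), (klTwoLegPieceG L M β U μ K i).eval q| ≤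
        2 * twoLegBar G Q U 0 (n + 1) := by
      intro q
      refine (hpre q).trans ?_
      have h16 : twoLegBar G Q U 0 n = 16 * twoLegBar G Q U 0 (n + 1) := by
        simp only [ct_twoLegBar_zero_eq, pow_succ, mul_inv]
        ring
      rw [h16]
      nlinarith [htlb0 (n + 1)]
    obtain ⟨hK', hren'', hS'⟩ := ct_stepH wig hG hQ hμ hR hcr blk hread hroomA hroomB h0 h1 h2 hK hn hren'
      (by linarith [htlb0 (n + 1)]) hpre' (hfeas (n + 1) hn)
    exact ⟨_, hK', hren'', hS'⟩

/-- **THE ONE-VOLUME CONTINUATION GIVEN THE READING, history-keyed**: at a volume carrying a history-keyed block and the reading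
inequality with slack `wig n ≤ |U|16^{-n}/256`, under the numeric side conditions on `U` and the three allowance sums, there is an
ADMISSIBLE frame whose scale-`n` local part is within HALF the quadratic tolerance at every scale `n ≤ nScales β` and every real angle. -/
theorem ct_oneVolume_of_readingH (hG : G.WF) (hQ : Q.WF) (hμ : μ ∈ klWindowC) (hR : ∀ j, 0 ≤ R.Gfr j) (hcr : R.cr = ctCr G)
    (blk : ∀ K : TrigPolyC4v, FrameOK R U (nScales β) μ K → ∀ n : ℕ, n ≤ nScales β →
      (∀ j < n, RenormalisedAtF L M β U μ K R j) →
        TwoLegStepG L M H G P Q R β U μ K n ∧ TwoLegSizesMS L M G Q R β U μ K n ∧ TwoLegAngularG L M G Q R β U μ K n ∧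
          (RenormalisedAtF L M β U μ K R n → H K n))
    (hread : ∀ K : TrigPolyC4v, FrameOK R U (nScales β) μ K → ∀ n : ℕ, n ≤ nScales β →
      (∀ j < n, RenormalisedAtF L M β U μ K R j) → ∀ B : ℝ,
        (∀ q : Fin 2 → ℝ, |K.eval q + ∑ i ∈ range (n + 1), (klTwoLegPieceG L M β U μ K i).eval q| ≤ B) →
          ∀ θ : ℝ, |klLocalPart L M β U μ K n θ| ≤ B + wig n)
    (hwig : ∀ n ≤ nScales β, wig n ≤ |U| * ((16 : ℝ) ^ n)⁻¹ / 256)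
    (hS0' : Q.S' 0 * |U| ≤ 1 / 10) (hq : 4 / 3 * (G.SL + Q.SL * |U|) * |U| ≤ 1 / 1000)
    (hroomA : ∀ j ≤ 4, 2 * (G.S j + Q.S' j * |U|) ≤ R.Gfr j) (hroomB : ∀ n : ℕ, ∑ i ∈ range (n + 1), msBar G Q U i ≤ 1 / 2)
    (h0 : ∑ m ∈ range (nScales β + 1), R.Gfr 0 * uPow 0 U * (4 : ℝ) ^ (((0 : ℤ) - 2) * m) ≤ 3 / 80)
    (h1 : ∑ m ∈ range (nScales β + 1), R.Gfr 1 * uPow 1 U * (4 : ℝ) ^ (((1 : ℤ) - 2) * m) ≤ 1 / 2000)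
    (h2 : ∑ m ∈ range (nScales β + 1), ∑ j ∈ range 3, R.Gfr j * uPow j U * (4 : ℝ) ^ (((j : ℤ) - 2) * m) ≤ 1 / 100) :
    ∃ K : TrigPolyC4v, FrameOK R U (nScales β) μ K ∧
      ∀ n ≤ nScales β, ∀ θ : ℝ, |klLocalPart L M β U μ K n θ| ≤ ctCr G * |U| * klScale klE0 n ^ 2 / klE0 / 2 := by
  obtain ⟨K, hK, hren, hS⟩ :=
    ct_exists_postH wig hG hQ hμ hR hcr blk hread hwig hS0' hq hroomA hroomB h0 h1 h2 (nScales β) le_rfl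
  refine ⟨K, hK, fun n hn θ => ?_⟩
  have h := hread K hK n hn (fun j hj => hren j (le_of_lt (lt_of_lt_of_le hj hn))) _ (hS n hn) θ
  exact h.trans (by have := ct_budget wig hG hQ hwig hS0' hq hn le_rfl; linarith)

end Main

end Summit.HubbardSuperconductivity.HubbardSuperconductivity.Theorems.KLRegimeSplit

end
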